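import Literature.NumberTheory.LFunctions.TwistedDedekindCoefficients
import HarnessLib

/-!
# Ideals of prime-power norm above an inert or a split rational prime, and the local Euler factors
# of a twisted `L`-series there

Helper file for the crux `PeterssonLowerBound` (stmt-ABC-10870), stub `stub_j0` (the CM family
`j = 0`, Hecke `L`-functions of `ℚ(ζ₃)` compared with `L(Sym² f)` prime by prime). For a number field
`K`, a completely multiplicative `ν : Ideal(𝓞 K) →*₀ ℂ` and the coefficients
`a_ν(n) = twistCount K ν n = Σ_{N(I)=n} ν(I)` (`TwistedDedekindCoefficients`), we compute `a_ν(p^e)`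
and the local factor `Σ_e a_ν(p^e)(p^e)^{-s}` at a rational prime `p` of one of the two shapes met in a
quadratic field (stated abstractly, so that no arithmetic of a specific field is needed here):

* `term_twistCount_prime_pow` — `term a_ν s (p^e) = a_ν(p^e) (p^{−s})^e`;
* INERT shape — a prime `P` of norm `p²` which is the only prime containing `p`:
  `a_ν(p^{2k}) = ν(P)^k`, `a_ν(p^{2k+1}) = 0`, and `Σ_e a_ν(p^e)(p^e)^{-s} = (1 − ν(P)p^{−2s})⁻¹`
  (`tsum_term_twistCount_of_inert`);
* SPLIT shape — two distinct primes `P₁, P₂` of norm `p`, the only primes containing `p`: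
  `a_ν(p^e) = Σ_{i+j=e} ν(P₁)^i ν(P₂)^j` and
  `Σ_e a_ν(p^e)(p^e)^{-s} = (1 − ν(P₁)p^{−s})⁻¹(1 − ν(P₂)p^{−s})⁻¹` (`tsum_term_twistCount_of_split`).

Everything is proved (unique factorisation of ideals in the Dedekind domain `𝓞 K`). [folklore]
-/

noncomputable section

set_option linter.dupNamespace false

open Complex Finset Filter Topology NumberField UniqueFactorizationMonoid
open scoped LSeries.notation
open Literature.NumberTheory.LFunctions Literature.NumberTheory.LFunctions.NumberField

namespace Summit.ABC.ABC.Theorems.PeterssonJ0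

variable {K : Type*} [Field K] [NumberField K] (ν : Ideal (𝓞 K) →*₀ ℂ)

/-! ### Prime factors of an ideal of prime-power norm -/

omit [NumberField K] in
/-- An ideal of norm `p^e` is nonzero. [folklore] -/
theorem ne_bot_of_absNorm_eq_prime_pow [NumberField K] {p e : ℕ} (hp : p.Prime) {I : Ideal (𝓞 K)}
    (hI : Ideal.absNorm I = p ^ e) : I ≠ ⊥ := by
  intro h
  rw [h, Ideal.absNorm_bot] at hI
  exact pow_ne_zero e hp.ne_zero hI.symm

/-- **A prime factor of an ideal of norm `p^e` is a nonzero prime ideal containing `p`.** [folklore] -/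
theorem mem_normalizedFactors_of_absNorm_eq {p e : ℕ} (hp : p.Prime) {I : Ideal (𝓞 K)}
    (hI : Ideal.absNorm I = p ^ e) {Q : Ideal (𝓞 K)} (hQ : Q ∈ normalizedFactors I) :
    Q.IsPrime ∧ Q ≠ ⊥ ∧ (p : 𝓞 K) ∈ Q := by
  have hI0 := ne_bot_of_absNorm_eq_prime_pow hp hI
  obtain ⟨hQp, hIQ⟩ := (Ideal.mem_normalizedFactors_iff hI0).mp hQ
  refine ⟨hQp, (prime_of_normalized_factor Q hQ).ne_zero, ?_⟩
  have hdvd : Ideal.absNorm Q ∣ p ^ e := hI ▸ Ideal.absNorm_dvd_absNorm_of_le hIQ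
  obtain ⟨j, -, hj⟩ := (Nat.dvd_prime_pow hp).mp hdvd
  have hmem : ((Ideal.absNorm Q : ℕ) : 𝓞 K) ∈ Q := Ideal.absNorm_mem Q
  rw [hj, Nat.cast_pow] at hmem
  exact hQp.mem_of_pow_mem j hmem

/-! ### Terms at prime powers -/

/-- `((p^e : ℕ) : ℂ)^s = ((p : ℂ)^s)^e` for the Dirichlet-series variable `s`. [folklore] -/
theorem natCast_pow_cpow_eq (p e : ℕ) (s : ℂ) : (((p ^ e : ℕ) : ℂ)) ^ s = ((p : ℂ) ^ s) ^ e := by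
  induction e with
  | zero => simp
  | succ e ih => rw [pow_succ, Nat.cast_mul, Complex.natCast_mul_natCast_cpow, ih, pow_succ]

/-- `term a_ν s (p^e) = a_ν(p^e) · (p^{-s})^e`. [folklore] -/
theorem term_twistCount_prime_pow {p : ℕ} (hp : p.Prime) (s : ℂ) (e : ℕ) :
    LSeries.term (twistCount K ν) s (p ^ e) = twistCount K ν (p ^ e) * ((p : ℂ) ^ (-s)) ^ e := by
  rw [LSeries.term_of_ne_zero (pow_ne_zero e hp.ne_zero), natCast_pow_cpow_eq, div_eq_mul_inv, ← inv_pow,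
    Complex.cpow_neg]

/-- `‖ν(P) p^{-s}‖ < 1` for `‖ν(P)‖ ≤ 1`, `p` prime and `Re s > 0`. [folklore] -/
theorem norm_mul_prime_cpow_neg_lt_one {u : ℂ} (hu : ‖u‖ ≤ 1) {p : ℕ} (hp : p.Prime) {s : ℂ} (hs : 0 < s.re) :
    ‖u * (p : ℂ) ^ (-s)‖ < 1 := by
  have hy : ‖(p : ℂ) ^ (-s)‖ < 1 := by
    rw [Complex.norm_natCast_cpow_of_pos hp.pos, Complex.neg_re]
    exact Real.rpow_lt_one_of_one_lt_of_neg (by exact_mod_cast hp.one_lt) (by linarith)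
  rw [norm_mul]
  calc ‖u‖ * ‖(p : ℂ) ^ (-s)‖ ≤ 1 * ‖(p : ℂ) ^ (-s)‖ := by gcongr
    _ < 1 := by rw [one_mul]; exact hy

/-! ### The inert shape: a single prime `P` of norm `p²` above `p` -/

section Inert

variable {p : ℕ} (hp : p.Prime) {P : Ideal (𝓞 K)} (hNP : Ideal.absNorm P = p ^ 2)
  (huniq : ∀ Q : Ideal (𝓞 K), Q.IsPrime → Q ≠ ⊥ → (p : 𝓞 K) ∈ Q → Q = P)
include hp hNP huniq

/-- An ideal of norm `p^e` is `P^k` with `e = 2k`. [folklore] -/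
theorem eq_pow_of_inert {e : ℕ} {I : Ideal (𝓞 K)} (hI : Ideal.absNorm I = p ^ e) :
    ∃ k : ℕ, I = P ^ k ∧ e = 2 * k := by
  have hI0 := ne_bot_of_absNorm_eq_prime_pow hp hI
  set k := Multiset.card (normalizedFactors I) with hk
  have hrep : normalizedFactors I = Multiset.replicate k P :=
    Multiset.eq_replicate.mpr ⟨rfl, fun Q hQ ↦ by
      obtain ⟨h1, h2, h3⟩ := mem_normalizedFactors_of_absNorm_eq hp hI hQ
      exact huniq Q h1 h2 h3⟩
  have hIeq : I = P ^ k := by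
    rw [← Ideal.prod_normalizedFactors_eq_self hI0, hrep, Multiset.prod_replicate]
  refine ⟨k, hIeq, Nat.pow_right_injective hp.two_le ?_⟩
  simp only
  rw [← hI, hIeq, map_pow, hNP, ← pow_mul]

/-- `idealsOfNorm K (p^{2k}) = {P^k}`. [folklore] -/
theorem idealsOfNorm_even_of_inert (k : ℕ) : idealsOfNorm K (p ^ (2 * k)) = {P ^ k} := by
  ext I
  rw [mem_idealsOfNorm, Finset.mem_singleton]
  constructor
  · intro hI
    obtain ⟨k', hIk', hk'⟩ := eq_pow_of_inert hp hNP huniq hI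
    obtain rfl : k = k' := by omega
    exact hIk'
  · rintro rfl
    rw [map_pow, hNP, ← pow_mul]

/-- `idealsOfNorm K (p^{2k+1}) = ∅`. [folklore] -/
theorem idealsOfNorm_odd_of_inert (k : ℕ) : idealsOfNorm K (p ^ (2 * k + 1)) = ∅ := by
  ext I
  rw [mem_idealsOfNorm]
  simp only [Finset.notMem_empty, iff_false]
  intro hI
  obtain ⟨k', -, hk'⟩ := eq_pow_of_inert hp hNP huniq hI
  omega

/-- **`a_ν(p^{2k}) = ν(P)^k`.** [folklore] -/
theorem twistCount_even_of_inert (k : ℕ) : twistCount K ν (p ^ (2 * k)) = ν P ^ k := by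
  rw [twistCount, idealsOfNorm_even_of_inert hp hNP huniq k, Finset.sum_singleton, map_pow]

/-- **`a_ν(p^{2k+1}) = 0`.** [folklore] -/
theorem twistCount_odd_of_inert (k : ℕ) : twistCount K ν (p ^ (2 * k + 1)) = 0 := by
  rw [twistCount, idealsOfNorm_odd_of_inert hp hNP huniq k, Finset.sum_empty]

/-- **The inert local factor**: `Σ_e a_ν(p^e)(p^e)^{-s} = (1 − ν(P) p^{−2s})⁻¹` for `‖ν(P)‖ ≤ 1`,
`Re s > 0`. [folklore] -/
theorem tsum_term_twistCount_of_inert (hνP : ‖ν P‖ ≤ 1) {s : ℂ} (hs : 0 < s.re) :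
    ∑' e : ℕ, LSeries.term (twistCount K ν) s (p ^ e) = (1 - ν P * (p : ℂ) ^ (-(2 * s)))⁻¹ := by
  set y : ℂ := (p : ℂ) ^ (-s) with hy
  have hs2 : 0 < (2 * s).re := by simp; linarith
  have hy2 : (p : ℂ) ^ (-(2 * s)) = y ^ 2 := by
    rw [hy, ← Complex.cpow_nat_mul]; congr 1; push_cast; ring
  set r : ℂ := ν P * y ^ 2 with hr
  have hr1 : ‖r‖ < 1 := by
    rw [hr, ← hy2]; exact norm_mul_prime_cpow_neg_lt_one hνP hp hs2
  have heven : ∀ k : ℕ, LSeries.term (twistCount K ν) s (p ^ (2 * k)) = r ^ k := fun k ↦ by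
    rw [term_twistCount_prime_pow ν hp, twistCount_even_of_inert ν hp hNP huniq, hr, mul_pow, ← pow_mul, ← hy]
  have hodd : ∀ k : ℕ, LSeries.term (twistCount K ν) s (p ^ (2 * k + 1)) = 0 := fun k ↦ by
    rw [term_twistCount_prime_pow ν hp, twistCount_odd_of_inert ν hp hNP huniq, zero_mul]
  have hse : Summable fun k : ℕ ↦ LSeries.term (twistCount K ν) s (p ^ (2 * k)) :=
    (summable_geometric_of_norm_lt_one hr1).congr fun k ↦ (heven k).symm
  have hso : Summable fun k : ℕ ↦ LSeries.term (twistCount K ν) s (p ^ (2 * k + 1)) :=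
    (summable_zero (α := ℂ)).congr fun k ↦ (hodd k).symm
  rw [← tsum_even_add_odd (f := fun e ↦ LSeries.term (twistCount K ν) s (p ^ e)) hse hso,
    tsum_congr heven, tsum_congr hodd, tsum_zero, add_zero, tsum_geometric_of_norm_lt_one hr1, hr, hy2]

end Inert

/-! ### The split shape: two distinct primes `P₁, P₂` of norm `p` above `p` -/

section Split

variable {p : ℕ} (hp : p.Prime) {P₁ P₂ : Ideal (𝓞 K)} (hP₁ : P₁.IsPrime) (hP₂ : P₂.IsPrime)
  (hP₁0 : P₁ ≠ ⊥) (hP₂0 : P₂ ≠ ⊥) (hne : P₁ ≠ P₂)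
  (hN₁ : Ideal.absNorm P₁ = p) (hN₂ : Ideal.absNorm P₂ = p)
  (huniq : ∀ Q : Ideal (𝓞 K), Q.IsPrime → Q ≠ ⊥ → (p : 𝓞 K) ∈ Q → Q = P₁ ∨ Q = P₂)

include hP₁ hP₂ hP₁0 hP₂0 hne in
/-- The exponents are recovered from `P₁^i P₂^j` by counting prime factors. [folklore] -/
theorem count_normalizedFactors_splitPow [DecidableEq (Ideal (𝓞 K))] (i j : ℕ) :
    Multiset.count P₁ (normalizedFactors (P₁ ^ i * P₂ ^ j)) = i ∧
      Multiset.count P₂ (normalizedFactors (P₁ ^ i * P₂ ^ j)) = j := by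
  have hirr₁ : Irreducible P₁ := (Ideal.prime_of_isPrime hP₁0 hP₁).irreducible
  have hirr₂ : Irreducible P₂ := (Ideal.prime_of_isPrime hP₂0 hP₂).irreducible
  have hnf : normalizedFactors (P₁ ^ i * P₂ ^ j) = i • {P₁} + j • {P₂} := by
    rw [normalizedFactors_mul (pow_ne_zero i hP₁0) (pow_ne_zero j hP₂0),
      normalizedFactors_pow, normalizedFactors_pow, normalizedFactors_irreducible hirr₁,
      normalizedFactors_irreducible hirr₂, normalize_eq, normalize_eq]
  rw [hnf, Multiset.count_add, Multiset.count_add, Multiset.count_nsmul, Multiset.count_nsmul,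
    Multiset.count_nsmul, Multiset.count_nsmul, Multiset.count_singleton_self,
    Multiset.count_singleton_self, Multiset.count_singleton, Multiset.count_singleton, if_neg hne,
    if_neg (Ne.symm hne)]
  simp

include hP₁ hP₂ hP₁0 hP₂0 hne in
/-- `(i, j) ↦ P₁^i P₂^j` is injective. [folklore] -/
theorem splitPow_injective : Function.Injective (fun ij : ℕ × ℕ ↦ P₁ ^ ij.1 * P₂ ^ ij.2) := by
  classical
  rintro ⟨i, j⟩ ⟨i', j'⟩ h
  obtain ⟨h1, h2⟩ := count_normalizedFactors_splitPow hP₁ hP₂ hP₁0 hP₂0 hne i j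
  obtain ⟨h1', h2'⟩ := count_normalizedFactors_splitPow hP₁ hP₂ hP₁0 hP₂0 hne i' j'
  have e : P₁ ^ i * P₂ ^ j = P₁ ^ i' * P₂ ^ j' := h
  rw [e] at h1 h2
  simp only [Prod.mk.injEq]
  exact ⟨h1.symm.trans h1', h2.symm.trans h2'⟩

include hN₁ hN₂ in
/-- `N(P₁^i P₂^j) = p^{i+j}`. [folklore] -/
theorem absNorm_splitPow (ij : ℕ × ℕ) : Ideal.absNorm (P₁ ^ ij.1 * P₂ ^ ij.2) = p ^ (ij.1 + ij.2) := by
  rw [map_mul, map_pow, map_pow, hN₁, hN₂, pow_add]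

include hp hne hN₁ hN₂ huniq in
/-- An ideal of norm `p^e` is `P₁^i P₂^j` with `i + j = e`. [folklore] -/
theorem eq_splitPow_of_split {e : ℕ} {I : Ideal (𝓞 K)} (hI : Ideal.absNorm I = p ^ e) :
    ∃ ij : ℕ × ℕ, ij ∈ antidiagonal e ∧ I = P₁ ^ ij.1 * P₂ ^ ij.2 := by
  classical
  have hI0 := ne_bot_of_absNorm_eq_prime_pow hp hI
  set a := Multiset.count P₁ (normalizedFactors I) with ha
  set b := Multiset.count P₂ (normalizedFactors I) with hb
  have hrep : normalizedFactors I = Multiset.replicate a P₁ + Multiset.replicate b P₂ := by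
    ext Q
    rw [Multiset.count_add, Multiset.count_replicate, Multiset.count_replicate]
    by_cases h1 : P₁ = Q
    · rw [if_pos h1, if_neg (fun h2 ↦ hne (h1.trans h2.symm)), add_zero, ← h1]
    by_cases h2 : P₂ = Q
    · rw [if_neg h1, if_pos h2, zero_add, ← h2]
    rw [if_neg h1, if_neg h2, add_zero]
    refine Multiset.count_eq_zero.mpr fun hQ ↦ ?_
    obtain ⟨hq1, hq2, hq3⟩ := mem_normalizedFactors_of_absNorm_eq hp hI hQ
    rcases huniq Q hq1 hq2 hq3 with h | h
    · exact h1 h.symm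
    · exact h2 h.symm
  have hIeq : I = P₁ ^ a * P₂ ^ b := by
    rw [← Ideal.prod_normalizedFactors_eq_self hI0, hrep, Multiset.prod_add, Multiset.prod_replicate,
      Multiset.prod_replicate]
  refine ⟨(a, b), Finset.HasAntidiagonal.mem_antidiagonal.mpr ?_, hIeq⟩
  have h := absNorm_splitPow hN₁ hN₂ (a, b)
  rw [← hIeq, hI] at h
  exact (Nat.pow_right_injective hp.two_le h).symm

include hp hne hN₁ hN₂ huniq in
/-- `idealsOfNorm K (p^e)` is the image of the antidiagonal under `(i, j) ↦ P₁^i P₂^j`. [folklore] -/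
theorem idealsOfNorm_of_split [DecidableEq (Ideal (𝓞 K))] (e : ℕ) :
    idealsOfNorm K (p ^ e) = (antidiagonal e).image (fun ij : ℕ × ℕ ↦ P₁ ^ ij.1 * P₂ ^ ij.2) := by
  ext I
  rw [mem_idealsOfNorm, Finset.mem_image]
  constructor
  · intro hI
    obtain ⟨ij, hij, rfl⟩ := eq_splitPow_of_split hp hne hN₁ hN₂ huniq hI
    exact ⟨ij, hij, rfl⟩
  · rintro ⟨ij, hij, rfl⟩
    rw [absNorm_splitPow hN₁ hN₂, Finset.HasAntidiagonal.mem_antidiagonal.mp hij]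

include hp hP₁ hP₂ hP₁0 hP₂0 hne hN₁ hN₂ huniq in
/-- **`a_ν(p^e) = Σ_{i+j=e} ν(P₁)^i ν(P₂)^j`.** [folklore] -/
theorem twistCount_of_split (e : ℕ) :
    twistCount K ν (p ^ e) = ∑ ij ∈ antidiagonal e, ν P₁ ^ ij.1 * ν P₂ ^ ij.2 := by
  classical
  rw [twistCount, idealsOfNorm_of_split hp hne hN₁ hN₂ huniq e,
    Finset.sum_image ((splitPow_injective hP₁ hP₂ hP₁0 hP₂0 hne).injOn)]
  refine Finset.sum_congr rfl fun ij _ ↦ ?_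
  rw [map_mul, map_pow, map_pow]

include hp hP₁ hP₂ hP₁0 hP₂0 hne hN₁ hN₂ huniq in
/-- **The split local factor**: `Σ_e a_ν(p^e)(p^e)^{-s} = (1 − ν(P₁)p^{−s})⁻¹ (1 − ν(P₂)p^{−s})⁻¹` for
`‖ν(P₁)‖, ‖ν(P₂)‖ ≤ 1`, `Re s > 0` (Cauchy product of two geometric series). [folklore] -/
theorem tsum_term_twistCount_of_split (hν₁ : ‖ν P₁‖ ≤ 1) (hν₂ : ‖ν P₂‖ ≤ 1) {s : ℂ} (hs : 0 < s.re) :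
    ∑' e : ℕ, LSeries.term (twistCount K ν) s (p ^ e) =
      (1 - ν P₁ * (p : ℂ) ^ (-s))⁻¹ * (1 - ν P₂ * (p : ℂ) ^ (-s))⁻¹ := by
  set y : ℂ := (p : ℂ) ^ (-s) with hy
  have hu : ‖ν P₁ * y‖ < 1 := norm_mul_prime_cpow_neg_lt_one hν₁ hp hs
  have hv : ‖ν P₂ * y‖ < 1 := norm_mul_prime_cpow_neg_lt_one hν₂ hp hs
  have hterm : ∀ e : ℕ, LSeries.term (twistCount K ν) s (p ^ e) =
      ∑ ij ∈ antidiagonal e, (ν P₁ * y) ^ ij.1 * (ν P₂ * y) ^ ij.2 := fun e ↦ by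
    rw [term_twistCount_prime_pow ν hp, twistCount_of_split ν hp hP₁ hP₂ hP₁0 hP₂0 hne hN₁ hN₂ huniq, ← hy,
      Finset.sum_mul]
    refine Finset.sum_congr rfl fun ij hij ↦ ?_
    rw [← Finset.HasAntidiagonal.mem_antidiagonal.mp hij, pow_add, mul_pow, mul_pow]
    ring
  have hsu : Summable fun n : ℕ ↦ ‖(ν P₁ * y) ^ n‖ := by
    simp_rw [norm_pow]; exact summable_geometric_of_lt_one (norm_nonneg _) hu
  have hsv : Summable fun n : ℕ ↦ ‖(ν P₂ * y) ^ n‖ := by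
    simp_rw [norm_pow]; exact summable_geometric_of_lt_one (norm_nonneg _) hv
  simp_rw [hterm]
  rw [← tsum_mul_tsum_eq_tsum_sum_antidiagonal_of_summable_norm hsu hsv, tsum_geometric_of_norm_lt_one hu,
    tsum_geometric_of_norm_lt_one hv]

end Split

end Summit.ABC.ABC.Theorems.PeterssonJ0

namespace Summit.ABC.ABC.Theorems

/-- **Registered sub-goal `stub_j0_primepow` of stub `stub_j0`** (crux stmt-ABC-10870): the prime-power
terms `((p^e : ℕ) : ℂ)^s = (p^s)^e` of the local Euler factors. [folklore] -/
theorem stub_j0_primepow : ∀ (p e : ℕ) (s : ℂ), (((p ^ e : ℕ) : ℂ)) ^ s = ((p : ℂ) ^ s) ^ e :=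
  PeterssonJ0.natCast_pow_cpow_eq

end Summit.ABC.ABC.Theorems

end
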